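/-
Copyright (c) 2026. All rights reserved.
Released under Apache 2.0 license as described in the file LICENSE.
Authors: abc-iut cell, R-W numerics crew seat abc-iut-W-num-2 (gen 3).
-/
import Literature.IUT.LogVolume.DifferentOrdDivisor
import Literature.IUT.LogVolume.DifferentEstimatesCorollaries
import Literature.IUT.LogVolume.GenuineLogThetaPoint
import Literature.IUT.LogVolume.UnitRadicalDifferent
import Literature.NumberTheory.NumberFields.SqrtNegOneZetaThreeDyadicIndices
import HarnessLib

/-!
# `√−1 ∈ K` forces WILD ramification at every dyadic place: `ord_u(𝔇_{K/ℤ}) ≥ e(u ∣ 2)`, i.e. `d_u ≥ 1`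

Classical local algebra (J.-P. Serre, *Corps locaux*, Ch. III §6 Prop. 13: `v_𝔓(𝔇) ≥ e` as soon as the residue
characteristic divides `e`), composed from three tree theorems — no new mathematics:

* `Literature.NumberTheory.NumberFields.two_dvd_ramificationIdx_of_sq_eq_neg_one` (`i² = −1` in a number field
  `K` ⟹ `2 ∣ e(u ∣ 2)` at every place `u ∋ 2`: `ℚ(ζ₄)` is totally ramified of degree `2` at `2`);
* `Literature.IUT.LogVolume.one_le_differentOrd_of_dvd` ([IUTchIV] Prop. 1.3 corollaries: `p ∣ e ⟹ 1 ≤ d` for a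
  `p`-adic field, the wild half of Serre's Prop. 13 in the cell's normalisation `ord(p) = 1`);
* the completion dictionary `absRamificationIdx_rescaledCompletion` / `differentOrd_rescaledCompletion`
  (`e(K_u) = e(u ∣ p)`, `d_u = ord_u(𝔇_{K/ℤ})/e(u ∣ p)`).

THIS FILE PROVES (theorems only, no definitions, no named facts):

* `ramificationIdx_le_multiplicity_differentIdeal_of_sq_eq_neg_one` — for a number field `K ∋ i`, `i² = −1`, and every
  finite place `u ∋ 2`: **`e(u ∣ 2) ≤ ord_u(𝔇_{K/ℤ})`** (the tame bound gives only `e − 1`);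
* `one_le_differentOrd_rescaledCompletion_two_of_sq_eq_neg_one` — the same in the norm-side language: **`1 ≤ d_u`** for
  the rescaled completion `K_u`;
* `three_halves_le_differentOrd_rescaledCompletion_two_of_sq_eq_neg_one` /
  `ramificationIdx_add_le_multiplicity_differentIdeal_of_sq_eq_neg_one` — the SHARP form **`d_u ≥ 3/2 − 1/e(u ∣ 2)`**, i.e.
  `e + e/2 − 1 ≤ ord_u(𝔇_{K/ℤ})`: abc-iut-W-neg-1's unit-radical lemma
  `add_div_sub_one_div_le_differentOrd_of_pow_prime_eq_unit` (`y^p = u`, `‖u^{p−1} − 1‖ = p⁻¹`) AT `p = 2`, `u = −1`, `y = i`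
  (`‖(−1)¹ − 1‖₂ = ‖2‖₂ = 2⁻¹`): the tower `ℚ₂ ⊂ ℚ₂(i) ⊂ K_u` with `d(ℚ₂(i)) = 1`, [IUTchIV] Prop. 1.3 (i);
* `Cor22.ThetaVolumeDatumAt.ramificationIdx_le_multiplicity_differentIdeal_over_two` /
  `Cor22.ThetaVolumeDatumAt.one_le_differentOrd_over_two` — at EVERY genuine Θ-volume datum `T` over any presented point
  ([IUTchIV] Cor. 2.2 (ii)) the field `K = T.K` contains `√−1` ([IUTchI] Def. 3.1 (a), `InitialThetaData.sqrt_neg_one_mem`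
  on `T.D`, pushed up `F → K`), hence ALL forms hold at every place of `T.K` over `2` (`…_over_two`, `one_le_differentOrd_over_two`, and the sharp
  `three_halves_le_differentOrd_over_two` / `ramificationIdx_add_le_multiplicity_differentIdeal_over_two`).

Consumer (abc-iut, branch C per-image line, row «C:PERIMAGE-DIFFSHARP», abc-iut-c312-d1): in the Step (ii) lower bound for
`log(𝔡^K)` the dyadic places contribute a FULL `log 2` (weight `d_u ≥ 1`) instead of the floor-`2` weight `(1 − 1/2)·log 2`;
desk value of the lever (this seat's two-engine column «DS+W+I1», kit j264486): +73 of the 2,158 Szpiro-bad `(triple, l)` pairs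
of R-W's N3 scan; the sharp form (`3/2 − 1/e`, rung «I+» at the rows with a pole at `2`) +20 more. Nothing here is disputed mathematics; nothing here bears on the status of [IUTchIII] Cor. 3.12.
[cite: SerreLocalFields1979, Ch. III §6 Prop. 13] [cite: NeukirchANT1999, Ch. II Prop. (6.8)]
-/

noncomputable section

open scoped NumberField

namespace Literature.IUT.LogVolume

open NumberField IsDedekindDomain Literature.NumberTheory.NumberFields

/-! ## 1. Number fields containing `√−1`: the dyadic places are wildly ramified -/

/-- **`√−1 ∈ K ⟹ 1 ≤ d_u` at every place `u ∣ 2`** (norm-side form, rescaled completion `K_u`, `ord(2) = 1`):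
`i² = −1` gives `2 ∣ e(u ∣ 2)` (`two_dvd_ramificationIdx_of_sq_eq_neg_one`), `e(K_u) = e(u ∣ 2)`
(`absRamificationIdx_rescaledCompletion`), and `2 ∣ e(K_u) ⟹ 1 ≤ d(K_u)` (`one_le_differentOrd_of_dvd`, Serre's
Prop. 13, wild case). [cite: SerreLocalFields1979, Ch. III §6 Prop. 13] [cite: NeukirchANT1999, Ch. II Prop. (6.8)] -/
theorem one_le_differentOrd_rescaledCompletion_two_of_sq_eq_neg_one {K : Type} [Field K] [NumberField K]
    {i : K} (hi : i ^ 2 = -1) (u : HeightOneSpectrum (𝓞 K)) (hu : ((2 : ℕ) : 𝓞 K) ∈ u.asIdeal) :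
    haveI : Fact (Nat.Prime 2) := ⟨Nat.prime_two⟩
    1 ≤ differentOrd 2 (RescaledCompletion K 2 u hu) := by
  haveI : Fact (Nat.Prime 2) := ⟨Nat.prime_two⟩
  have h2 : 2 ∣ u.asIdeal.ramificationIdx ℤ := two_dvd_ramificationIdx_of_sq_eq_neg_one hi u hu
  have h2' : 2 ∣ absRamificationIdx 2 (RescaledCompletion K 2 u hu) := by
    rwa [absRamificationIdx_rescaledCompletion]
  exact one_le_differentOrd_of_dvd 2 (RescaledCompletion K 2 u hu) h2'

/-- **`√−1 ∈ K ⟹ e(u ∣ 2) ≤ ord_u(𝔇_{K/ℤ})` at every place `u ∣ 2`** (ideal-side form): the multiplicity of `u` in the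
absolute different is at least the ramification index — WILD ramification at `2` (the tame bound is `e − 1`). From the
norm-side form and `d_u = ord_u(𝔇)/e(u ∣ 2)` (`differentOrd_rescaledCompletion`).
[cite: SerreLocalFields1979, Ch. III §6 Prop. 13] [cite: NeukirchANT1999, Ch. II Prop. (6.8)] -/
theorem ramificationIdx_le_multiplicity_differentIdeal_of_sq_eq_neg_one {K : Type} [Field K] [NumberField K]
    {i : K} (hi : i ^ 2 = -1) (u : HeightOneSpectrum (𝓞 K)) (hu : ((2 : ℕ) : 𝓞 K) ∈ u.asIdeal) :
    u.asIdeal.ramificationIdx ℤ ≤ multiplicity u.asIdeal (differentIdeal ℤ (𝓞 K)) := by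
  haveI : Fact (Nat.Prime 2) := ⟨Nat.prime_two⟩
  have h1 := one_le_differentOrd_rescaledCompletion_two_of_sq_eq_neg_one hi u hu
  rw [differentOrd_rescaledCompletion] at h1
  have he0 : (0 : ℝ) < (u.asIdeal.ramificationIdx ℤ : ℝ) := by exact_mod_cast Ideal.ramificationIdx_pos _ _
  rw [le_div_iff₀ he0, one_mul] at h1
  exact_mod_cast h1


/-! ## 1b. The sharp form `d_u ≥ 3/2 − 1/e(u ∣ 2)` via abc-iut-W-neg-1's unit-radical lemma at `p = 2`, `u = −1` -/

/-- **`√−1 ∈ K ⟹ (e + e/2 − 1)/e ≤ d_u` at every place `u ∣ 2`** (`e = e(u ∣ 2)`; norm-side, rescaled completion):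
`i² = −1 = y^p` with `p = 2`, `u = −1 ∈ ℚ₂`, `‖u^{p−1} − 1‖ = ‖−2‖₂ = 2⁻¹`, so abc-iut-W-neg-1's
`add_div_sub_one_div_le_differentOrd_of_pow_prime_eq_unit` (the tower `ℚ₂ ⊂ ℚ₂(i) ⊂ K_u`, `e(ℚ₂(i)) = 2`, `d(ℚ₂(i)) ≥ 1`,
[IUTchIV] Prop. 1.3 (i)) applies verbatim. [cite: SerreLocalFields1979, Ch. III §6 Prop. 13] [cite: Mochizuki2012, IUTchIV Prop. 1.3 (i) p. 11]
[claim: Mochizuki2012, status: disputed] -/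
theorem three_halves_le_differentOrd_rescaledCompletion_two_of_sq_eq_neg_one {K : Type} [Field K] [NumberField K]
    {i : K} (hi : i ^ 2 = -1) (u : HeightOneSpectrum (𝓞 K)) (hu : ((2 : ℕ) : 𝓞 K) ∈ u.asIdeal) :
    haveI : Fact (Nat.Prime 2) := ⟨Nat.prime_two⟩
    ((absRamificationIdx 2 (RescaledCompletion K 2 u hu) + absRamificationIdx 2 (RescaledCompletion K 2 u hu) / 2 - 1 : ℕ) : ℝ) /
        (absRamificationIdx 2 (RescaledCompletion K 2 u hu) : ℝ) ≤
      differentOrd 2 (RescaledCompletion K 2 u hu) := by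
  haveI : Fact (Nat.Prime 2) := ⟨Nat.prime_two⟩
  letI : Algebra K (RescaledCompletion K 2 u hu) := inferInstanceAs (Algebra K (u.adicCompletion K))
  have hu' : ‖(-1 : ℚ_[2]) ^ (2 - 1) - 1‖ = ((2 : ℕ) : ℝ)⁻¹ := by
    rw [show (2 - 1 : ℕ) = 1 from rfl, pow_one, show (-1 : ℚ_[2]) - 1 = -(2 : ℚ_[2]) by ring, norm_neg]
    exact_mod_cast Padic.norm_p (p := 2)
  have hy : (algebraMap K (RescaledCompletion K 2 u hu) i) ^ 2 = algebraMap ℚ_[2] (RescaledCompletion K 2 u hu) (-1) := by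
    rw [← map_pow, hi, map_neg, map_one, map_neg, map_one]
  exact add_div_sub_one_div_le_differentOrd_of_pow_prime_eq_unit 2 hu' hy

/-- **`√−1 ∈ K ⟹ e(u ∣ 2) + e(u ∣ 2)/2 − 1 ≤ ord_u(𝔇_{K/ℤ})` at every place `u ∣ 2`** (ideal side; `e(u ∣ 2)` is even, so this is
`(3/2)·e − 1`). From the norm-side sharp form and the completion dictionary. [cite: SerreLocalFields1979, Ch. III §6 Prop. 13]
[cite: NeukirchANT1999, Ch. II Prop. (6.8)] -/
theorem ramificationIdx_add_le_multiplicity_differentIdeal_of_sq_eq_neg_one {K : Type} [Field K] [NumberField K]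
    {i : K} (hi : i ^ 2 = -1) (u : HeightOneSpectrum (𝓞 K)) (hu : ((2 : ℕ) : 𝓞 K) ∈ u.asIdeal) :
    u.asIdeal.ramificationIdx ℤ + u.asIdeal.ramificationIdx ℤ / 2 - 1 ≤ multiplicity u.asIdeal (differentIdeal ℤ (𝓞 K)) := by
  haveI : Fact (Nat.Prime 2) := ⟨Nat.prime_two⟩
  have h1 := three_halves_le_differentOrd_rescaledCompletion_two_of_sq_eq_neg_one hi u hu
  rw [differentOrd_rescaledCompletion, absRamificationIdx_rescaledCompletion] at h1
  have he0 : (0 : ℝ) < (u.asIdeal.ramificationIdx ℤ : ℝ) := by exact_mod_cast Ideal.ramificationIdx_pos _ _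
  rw [div_le_div_iff_of_pos_right he0] at h1
  exact_mod_cast h1

/-! ## 2. At a genuine Θ-volume datum: `√−1 ∈ F ⊆ K` ([IUTchI] Def. 3.1 (a)) -/

namespace Cor22

open Literature.IUT.HodgeTheaters Literature.NumberTheory.DiophantineGeometry.GenEll

namespace ThetaVolumeDatumAt

variable {P : NFPoint} {l : ℕ} (T : ThetaVolumeDatumAt P l)

/-- **`√−1 ∈ K` at a genuine Θ-volume datum**: [IUTchI] Def. 3.1 (a) requires `√−1 ∈ F` (the field
`InitialThetaData.sqrt_neg_one_mem` of `T.D`); its image under `F → K` squares to `−1` in `K`.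
[cite: Mochizuki2012, IUTchI Def. 3.1 (a) p. 61] [claim: Mochizuki2012, status: disputed] -/
theorem exists_sq_eq_neg_one_K :
    letI := T.instFieldF; letI := T.instFieldK; letI := T.instAlgebraK
    ∃ i : T.K, i ^ 2 = -1 := by
  letI := T.instFieldF; letI := T.instNumberFieldF; letI := T.instAlgebraF; letI := T.instFieldK
  letI := T.instNumberFieldK; letI := T.instAlgebraK; letI := T.instFieldFbar; letI := T.instAlgebraFbar
  letI := T.instAlgebraKFbar; letI := T.instIsElliptic
  obtain ⟨i, hi⟩ := T.D.sqrt_neg_one_mem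
  refine ⟨algebraMap T.F T.K i, ?_⟩
  rw [← map_pow, hi, map_neg, map_one]

/-- **At EVERY genuine Θ-volume datum `T`, every place `u ∣ 2` of `K` is WILDLY ramified: `e(u ∣ 2) ≤ ord_u(𝔇_{K/ℤ})`**
(`√−1 ∈ K` by [IUTchI] Def. 3.1 (a) + `ramificationIdx_le_multiplicity_differentIdeal_of_sq_eq_neg_one`). In the Step (ii)
lower bound for `log(𝔡^K)` ([IUTchIV] Thm. 1.10 Step (ii) p. 24) the dyadic places therefore carry the full weight `log 2`.
[cite: Mochizuki2012, IUTchI Def. 3.1 (a) p. 61; IUTchIV Thm. 1.10 Step (ii) p. 24] [cite: SerreLocalFields1979, Ch. III §6 Prop. 13]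
[claim: Mochizuki2012, status: disputed] -/
theorem ramificationIdx_le_multiplicity_differentIdeal_over_two :
    letI := T.instFieldK; letI := T.instNumberFieldK
    ∀ u : HeightOneSpectrum (𝓞 T.K), ((2 : ℕ) : 𝓞 T.K) ∈ u.asIdeal →
      u.asIdeal.ramificationIdx ℤ ≤ multiplicity u.asIdeal (differentIdeal ℤ (𝓞 T.K)) := by
  letI := T.instFieldF; letI := T.instFieldK; letI := T.instNumberFieldK; letI := T.instAlgebraK
  intro u hu
  obtain ⟨i, hi⟩ := T.exists_sq_eq_neg_one_K
  exact ramificationIdx_le_multiplicity_differentIdeal_of_sq_eq_neg_one hi u hu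

/-- **At EVERY genuine Θ-volume datum `T`: `1 ≤ d_u` for every place `u ∣ 2` of `K`** (norm-side form on the rescaled
completion `K_u`, `ord(2) = 1`; `√−1 ∈ K` by [IUTchI] Def. 3.1 (a)). [cite: Mochizuki2012, IUTchI Def. 3.1 (a) p. 61;
IUTchIV Prop. 1.3 (i) p. 11] [cite: SerreLocalFields1979, Ch. III §6 Prop. 13] [claim: Mochizuki2012, status: disputed] -/
theorem one_le_differentOrd_over_two :
    letI := T.instFieldK; letI := T.instNumberFieldK
    haveI : Fact (Nat.Prime 2) := ⟨Nat.prime_two⟩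
    ∀ (u : HeightOneSpectrum (𝓞 T.K)) (hu : ((2 : ℕ) : 𝓞 T.K) ∈ u.asIdeal),
      1 ≤ differentOrd 2 (RescaledCompletion T.K 2 u hu) := by
  letI := T.instFieldF; letI := T.instFieldK; letI := T.instNumberFieldK; letI := T.instAlgebraK
  intro u hu
  obtain ⟨i, hi⟩ := T.exists_sq_eq_neg_one_K
  exact one_le_differentOrd_rescaledCompletion_two_of_sq_eq_neg_one hi u hu

/-- **At EVERY genuine Θ-volume datum `T`: `e(u ∣ 2) + e(u ∣ 2)/2 − 1 ≤ ord_u(𝔇_{K/ℤ})` for every place `u ∣ 2` of `K`** (the sharp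
dyadic different bound, `d_u ≥ 3/2 − 1/e`; `√−1 ∈ K` by [IUTchI] Def. 3.1 (a)). [cite: Mochizuki2012, IUTchI Def. 3.1 (a) p. 61;
IUTchIV Prop. 1.3 (i) p. 11, Thm. 1.10 Step (ii) p. 24] [cite: SerreLocalFields1979, Ch. III §6 Prop. 13] [claim: Mochizuki2012, status: disputed] -/
theorem ramificationIdx_add_le_multiplicity_differentIdeal_over_two :
    letI := T.instFieldK; letI := T.instNumberFieldK
    ∀ u : HeightOneSpectrum (𝓞 T.K), ((2 : ℕ) : 𝓞 T.K) ∈ u.asIdeal →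
      u.asIdeal.ramificationIdx ℤ + u.asIdeal.ramificationIdx ℤ / 2 - 1 ≤ multiplicity u.asIdeal (differentIdeal ℤ (𝓞 T.K)) := by
  letI := T.instFieldF; letI := T.instFieldK; letI := T.instNumberFieldK; letI := T.instAlgebraK
  intro u hu
  obtain ⟨i, hi⟩ := T.exists_sq_eq_neg_one_K
  exact ramificationIdx_add_le_multiplicity_differentIdeal_of_sq_eq_neg_one hi u hu

/-- **At EVERY genuine Θ-volume datum `T`: `(e + e/2 − 1)/e ≤ d_u` for every place `u ∣ 2` of `K`** (norm-side sharp form on the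
rescaled completion `K_u`, `e = e(K_u)`). [cite: Mochizuki2012, IUTchI Def. 3.1 (a) p. 61; IUTchIV Prop. 1.3 (i) p. 11]
[cite: SerreLocalFields1979, Ch. III §6 Prop. 13] [claim: Mochizuki2012, status: disputed] -/
theorem three_halves_le_differentOrd_over_two :
    letI := T.instFieldK; letI := T.instNumberFieldK
    haveI : Fact (Nat.Prime 2) := ⟨Nat.prime_two⟩
    ∀ (u : HeightOneSpectrum (𝓞 T.K)) (hu : ((2 : ℕ) : 𝓞 T.K) ∈ u.asIdeal),
      ((absRamificationIdx 2 (RescaledCompletion T.K 2 u hu) + absRamificationIdx 2 (RescaledCompletion T.K 2 u hu) / 2 - 1 : ℕ) : ℝ) /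
          (absRamificationIdx 2 (RescaledCompletion T.K 2 u hu) : ℝ) ≤
        differentOrd 2 (RescaledCompletion T.K 2 u hu) := by
  letI := T.instFieldF; letI := T.instFieldK; letI := T.instNumberFieldK; letI := T.instAlgebraK
  intro u hu
  obtain ⟨i, hi⟩ := T.exists_sq_eq_neg_one_K
  exact three_halves_le_differentOrd_rescaledCompletion_two_of_sq_eq_neg_one hi u hu

end ThetaVolumeDatumAt

end Cor22

end Literature.IUT.LogVolume
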